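import Literature.Analysis.FluidPDE.TorusNSMillerCriterion
import Literature.Analysis.FluidPDE.TorusNSEnstrophyContinuation
import HarnessLib

/-!
# Neustupa–Penel: regularity in dependence on ONE eigenvalue of the rate-of-deformation tensor —
# the `ζ₁` and `ζ₃` alternatives on `T³` (continuation form)

search for candidate a priori estimates; no regularity claim (cell `pub-nsfunc`, literature seat:
this file types a PUBLISHED criterion, nothing new).

Analysis/FluidPDE file (theorems only; no definitions, no named facts). J. Neustupa, P. Penel,
*The role of eigenvalues and eigenvectors of the symmetrized gradient of velocity in the theory of
the Navier–Stokes equations*, C. R. Acad. Sci. Paris, Ser. I 336 (2003) 805–810, Theorem 2.1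
(= Théorème 1): "Suppose that `D` is an open sub-domain of `Q_T`, `(v; p)` is a suitable weak
solution …, `ζ₁ ≤ ζ₂ ≤ ζ₃` are the eigenvalues of the tensor `½(vᵢ,ⱼ + vⱼ,ᵢ)` and ONE of the
functions `ζ₁, (ζ₂)₊, ζ₃` belongs to `L^{r,s}_{loc}(D)` for some real numbers `r, s` such that
`1 ≤ r ≤ +∞`, `3/2 < s ≤ +∞` and `2/r + 3/s ≤ 2`. Then the solution `(v; p)` is regular in `D`."
The mechanism (eq. (13), "Idée de la démonstration"): `ζ₁ ≤ 0`, `ζ₃ ≥ 0`, `ζ₁ + ζ₂ + ζ₃ = 0`, so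
`(ζ₂)₊ ≤ ζ₃` and `(ζ₂)₊ ≤ −ζ₁ = |ζ₁|` pointwise — a bound on `ζ₃` or on `|ζ₁|` is a bound on
`(ζ₂)₊`, and the `(ζ₂)₊` case is the one with content (`d/dt (3/8)∫|∇u|² + (3ν/4)∫|Δu|² ≤
−3∫λ₁λ₂λ₃ + …`).

The `(ζ₂)₊` alternative is in the tree on the flat torus in the cell's CONTINUATION form for
classical mean-zero solutions (Miller, ARMA 235 (2020) Thm 1.1, who re-derived and sharpened the
Neustupa–Penel criterion: `Torus.classicalNS_continuation_of_middleEigenvalue_integral_le` (`s = ∞`)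
and `Torus.classicalNS_continuation_of_middleEigenvalue_Lq_rpow_integral_le` (`3/2 < s < ∞`), with
the `L^s` hypothesis on a continuous pointwise MAJORANT field of the middle eigenvalue). This file
adds the two other alternatives of Neustupa–Penel's Thm 2.1 in the same form, by the pointwise
eigenvalue bookkeeping `λ₂ ≤ λ₁`, `λ₂ ≤ −λ₃` of a trace-free symmetric `3 × 3` matrix (spectral
theorem; cf. the tree's `Chae2005.eigenvalues_basic` in `TorusStrainSpectralDynamics`, re-derived here to
keep the imports light; Mathlib's `eigenvalues₀` is sorted DECREASINGLY, so `eigenvalues₀ 0 = ζ₃` is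
the largest and `eigenvalues₀ 2 = ζ₁` the smallest):

* `Torus.classicalNS_continuation_of_topEigenvalue_integral_le` /
  `Torus.classicalNS_continuation_of_topEigenvalue_Lq_rpow_integral_le` — the `ζ₃` alternative
  (`s = ∞`, resp. `3/2 < s < ∞` with `r = 2s/(2s−3)`, `2/r + 3/s = 2`);
* `Torus.classicalNS_continuation_of_negBotEigenvalue_integral_le` /
  `Torus.classicalNS_continuation_of_negBotEigenvalue_Lq_rpow_integral_le` — the `ζ₁` alternative
  (majorant of `−ζ₁ = |ζ₁|`).

Scope (faithfulness): Neustupa–Penel state an INTERIOR (local, `L^{r,s}_{loc}(D)`) criterion for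
suitable weak solutions via the CKN localisation (Lemma 1.1); typed here is the global periodic
classical CONTINUATION form on the unit torus (`card d = 3`), with the integrability hypothesis on a
continuous majorant field and the scaling-critical line `2/r + 3/s = 2` (the printed `≤ 2` on a
bounded time interval reduces to it by Hölder in time); the local statement and the eigenVECTOR
criterion (Thm 3.1) are NOT typed.

## Mathlib / tree search

Tree (used): `Torus.classicalNS_continuation_of_middleEigenvalue_integral_le`
(`TorusNSEnstrophyContinuation`), `Torus.classicalNS_continuation_of_middleEigenvalue_Lq_rpow_integral_le`
(`TorusNSMillerCriterion`), `Torus.divergence_eq_sum_partialDeriv_apply`; Mathlib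
`Matrix.IsHermitian.eigenvalues₀_antitone`, `Matrix.IsHermitian.trace_eq_sum_eigenvalues`. Searched (`lean search`):
`topEigenvalue.*continuation|botEigenvalue|NeustupaPenel` — the bib key `NeustupaPenel2001` is cited
in `GradientRegularityCriteria` / `MillerMiddleEigenvalueCriterion` docstrings only; no `ζ₁`/`ζ₃`
statement exists. Literature: the CRAS note is held (`paper:doi-10-1016-s1631-073x-03-00174-2`,
pp. 1–6 read, Thm 2.1 p. 5).

## References

* J. Neustupa, P. Penel, C. R. Acad. Sci. Paris, Ser. I 336 (2003) 805–810,
  doi:10.1016/S1631-073X(03)00174-2, Thm 2.1 (p. 809) and eq. (13). [NeustupaPenel2003]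
* J. Neustupa, P. Penel, *Anisotropic and geometric criteria for interior regularity of weak
  solutions to the 3D Navier–Stokes equations*, in: Mathematical Fluid Mechanics, Birkhäuser 2001,
  237–268 (the `(ζ₂)₊` criterion). [NeustupaPenel2001]
* E. Miller, Arch. Ration. Mech. Anal. 235 (2020) 99–139, Thm 1.1 (the `(ζ₂)₊` criterion in
  `L^p_t L^q_x`, torus remark p. 6). [Miller2019]
-/

noncomputable section

open Set MeasureTheory intervalIntegral Filter Real Matrix
open scoped InnerProductSpace RealInnerProductSpace Topology ENNReal

namespace Literature.Analysis.FluidPDE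

open Literature.Analysis.FunctionSpaces

variable {d : Type*} [Fintype d] [DecidableEq d]

namespace NeustupaPenel2003

/-- Sorted eigenvalues of a real symmetric trace-free matrix over a `3`-element index type:
`λ₂ ≤ λ₁` and `λ₂ ≤ −λ₃` (`λ_k = eigenvalues₀ k` decreasing, `λ₁ + λ₂ + λ₃ = tr M = 0`; Neustupa–Penel:
"`ζ₁ ≤ 0`, `ζ₃ ≥ 0` and `ζ₁ + ζ₂ + ζ₃ = 0`"). [cite: NeustupaPenel2003, Thm 2.1 (idée de la démonstration)] -/
theorem eigenvalues_middle_le {n : Type*} [Fintype n] [DecidableEq n] (hn : Fintype.card n = 3)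
    (M : Matrix n n ℝ) (hH : M.IsHermitian) (htr : M.trace = 0) :
    hH.eigenvalues₀ (Fin.cast hn.symm 1) ≤ hH.eigenvalues₀ (Fin.cast hn.symm 0) ∧
      hH.eigenvalues₀ (Fin.cast hn.symm 1) ≤ -hH.eigenvalues₀ (Fin.cast hn.symm 2) := by
  set lam : Fin 3 → ℝ := fun a => hH.eigenvalues₀ (Fin.cast hn.symm a) with hlam
  have hE : ∑ i, hH.eigenvalues i = ∑ a : Fin 3, lam a := by
    have h1 : ∑ i, hH.eigenvalues i = ∑ k, hH.eigenvalues₀ k :=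
      Fintype.sum_equiv (Fintype.equivOfCardEq (Fintype.card_fin _)).symm _ _ (fun i => rfl)
    rw [h1]
    exact Fintype.sum_equiv (finCongr hn) _ _ (fun k => by simp [hlam, finCongr])
  have htr' : ∑ a : Fin 3, lam a = 0 := by
    have := hH.trace_eq_sum_eigenvalues
    simp only [RCLike.ofReal_real_eq_id, id_eq] at this
    rw [← hE, ← this, htr]
  have hanti : Antitone lam := fun a b hab =>
    hH.eigenvalues₀_antitone ((Fin.cast_le_cast hn.symm).mpr hab)
  simp only [Fin.sum_univ_three] at htr'
  have h10 : lam 1 ≤ lam 0 := hanti (by decide)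
  have h21 : lam 2 ≤ lam 1 := hanti (by decide)
  refine ⟨h10, ?_⟩
  show lam 1 ≤ -lam 2
  linarith

/-- `tr S(x) = div v(x) = 0` for the strain matrix of a `C¹` divergence-free field. [folklore] -/
private theorem trace_strain_eq_zero {v : UnitAddTorus d → EuclideanSpace ℝ d}
    (hv : Torus.IsContDiff 1 v) (hdiv : Torus.IsDivFree v) (x : UnitAddTorus d) :
    (Matrix.of fun i j => (Torus.partialDeriv j v x i + Torus.partialDeriv i v x j) / 2).trace = 0 := by
  simp only [Matrix.trace, Matrix.diag, Matrix.of_apply]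
  have h1 : ∑ i, (Torus.partialDeriv i v x i + Torus.partialDeriv i v x i) / 2 =
      ∑ i, Torus.partialDeriv i v x i := Finset.sum_congr rfl fun i _ => by ring
  rw [h1, ← Torus.divergence_eq_sum_partialDeriv_apply hv x]
  exact hdiv x

/-- Pointwise step of Neustupa–Penel's Thm 2.1 for the strain matrix of a `C¹` divergence-free field
on `T^d`, `card d = 3`: the middle eigenvalue is bounded by the top one and by minus the bottom one,
`ζ₂ ≤ ζ₃` and `ζ₂ ≤ −ζ₁` (in Mathlib's decreasing order: `eigenvalues₀ 1 ≤ eigenvalues₀ 0` and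
`eigenvalues₀ 1 ≤ −eigenvalues₀ 2`). [cite: NeustupaPenel2003, Thm 2.1 (idée de la démonstration: ζ₁ ≤ 0, ζ₃ ≥ 0, ζ₁+ζ₂+ζ₃ = 0)] -/
theorem middleEigenvalue_le_top_and_le_neg_bot (hd : Fintype.card d = 3)
    {v : UnitAddTorus d → EuclideanSpace ℝ d} (hv : Torus.IsContDiff 1 v) (hdiv : Torus.IsDivFree v)
    (x : UnitAddTorus d)
    (hx : (Matrix.of fun i j => (Torus.partialDeriv j v x i + Torus.partialDeriv i v x j) / 2).IsHermitian) :
    hx.eigenvalues₀ (Fin.cast hd.symm 1) ≤ hx.eigenvalues₀ (Fin.cast hd.symm 0) ∧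
      hx.eigenvalues₀ (Fin.cast hd.symm 1) ≤ -hx.eigenvalues₀ (Fin.cast hd.symm 2) :=
  eigenvalues_middle_le hd _ hx (trace_strain_eq_zero hv hdiv x)

end NeustupaPenel2003

/-- **Neustupa–Penel, the `ζ₃` alternative, `s = ∞`** (CRAS 336 (2003) Thm 2.1 with `r = 1`,
`s = ∞`: the LARGEST eigenvalue `ζ₃` of the rate-of-deformation tensor in `L¹(0,T; L^∞)` gives
regularity), continuation form on `T³`: for a classical mean-zero solution of the unforced equations
on `[0, T) × T^d` (`card d = 3`, `ν > 0`), a continuous `Λ ≥ 0` on `[0, T)` with `ζ₃(t, x) ≤ Λ(t)`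
for all `x` (top sorted eigenvalue `eigenvalues₀ 0` of the strain matrix) and `∫₀ᵗ Λ ≤ I` for all
`t < T` yields continuation past `T` (since `(ζ₂)₊ ≤ ζ₃`, by
`Torus.classicalNS_continuation_of_middleEigenvalue_integral_le`). [cite: NeustupaPenel2003, Thm 2.1 (case ζ₃, s = ∞)] -/
theorem Torus.classicalNS_continuation_of_topEigenvalue_integral_le (hd : Fintype.card d = 3)
    {ν T : ℝ} (hν : 0 < ν) (hT : 0 < T) {u : ℝ → UnitAddTorus d → EuclideanSpace ℝ d}
    {p : ℝ → UnitAddTorus d → ℝ} (h : Torus.IsClassicalNSSolutionOn (Ico 0 T) ν 0 u p)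
    (hmean : ∀ t ∈ Ico 0 T, Torus.HasZeroMean (u t)) {Λ : ℝ → ℝ}
    (hΛc : ContinuousOn Λ (Ico 0 T)) (hΛ0 : ∀ t ∈ Ico 0 T, 0 ≤ Λ t)
    (hΛ : ∀ t ∈ Ico 0 T, ∀ x, ∀ hx : (Matrix.of fun i j =>
        (Torus.partialDeriv j (u t) x i + Torus.partialDeriv i (u t) x j) / 2).IsHermitian,
        hx.eigenvalues₀ (Fin.cast hd.symm 0) ≤ Λ t)
    {I : ℝ} (hI : ∀ t ∈ Ico 0 T, ∫ s in (0 : ℝ)..t, Λ s ≤ I) :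
    ∃ T' : ℝ, T < T' ∧ ∃ (u' : ℝ → UnitAddTorus d → EuclideanSpace ℝ d)
      (p' : ℝ → UnitAddTorus d → ℝ), Torus.IsClassicalNSSolutionOn (Icc 0 T') ν 0 u' p' ∧
        (∀ t ∈ Icc 0 T', Torus.HasZeroMean (u' t)) ∧ ∀ t ∈ Ico 0 T, u' t = u t :=
  Torus.classicalNS_continuation_of_middleEigenvalue_integral_le hd hν hT h hmean hΛc hΛ0
    (fun t ht x hx => (NeustupaPenel2003.middleEigenvalue_le_top_and_le_neg_bot hd
      ((h.smooth_velocity.isSmooth_slice ht).isContDiff (by simp)) (h.divFree t ht) x hx).1.trans (hΛ t ht x hx)) hI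

/-- **Neustupa–Penel, the `ζ₁` alternative, `s = ∞`** (CRAS 336 (2003) Thm 2.1 with `r = 1`,
`s = ∞`: the SMALLEST eigenvalue `ζ₁ ≤ 0` in `L¹(0,T; L^∞)`), continuation form on `T³`: a continuous
`Λ ≥ 0` on `[0, T)` with `−ζ₁(t, x) ≤ Λ(t)` (`ζ₁ = eigenvalues₀ 2`, the bottom sorted eigenvalue of
the strain matrix) and `∫₀ᵗ Λ ≤ I` yields continuation past `T` (since `(ζ₂)₊ ≤ −ζ₁`).
[cite: NeustupaPenel2003, Thm 2.1 (case ζ₁, s = ∞)] -/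
theorem Torus.classicalNS_continuation_of_negBotEigenvalue_integral_le (hd : Fintype.card d = 3)
    {ν T : ℝ} (hν : 0 < ν) (hT : 0 < T) {u : ℝ → UnitAddTorus d → EuclideanSpace ℝ d}
    {p : ℝ → UnitAddTorus d → ℝ} (h : Torus.IsClassicalNSSolutionOn (Ico 0 T) ν 0 u p)
    (hmean : ∀ t ∈ Ico 0 T, Torus.HasZeroMean (u t)) {Λ : ℝ → ℝ}
    (hΛc : ContinuousOn Λ (Ico 0 T)) (hΛ0 : ∀ t ∈ Ico 0 T, 0 ≤ Λ t)
    (hΛ : ∀ t ∈ Ico 0 T, ∀ x, ∀ hx : (Matrix.of fun i j =>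
        (Torus.partialDeriv j (u t) x i + Torus.partialDeriv i (u t) x j) / 2).IsHermitian,
        -hx.eigenvalues₀ (Fin.cast hd.symm 2) ≤ Λ t)
    {I : ℝ} (hI : ∀ t ∈ Ico 0 T, ∫ s in (0 : ℝ)..t, Λ s ≤ I) :
    ∃ T' : ℝ, T < T' ∧ ∃ (u' : ℝ → UnitAddTorus d → EuclideanSpace ℝ d)
      (p' : ℝ → UnitAddTorus d → ℝ), Torus.IsClassicalNSSolutionOn (Icc 0 T') ν 0 u' p' ∧
        (∀ t ∈ Icc 0 T', Torus.HasZeroMean (u' t)) ∧ ∀ t ∈ Ico 0 T, u' t = u t :=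
  Torus.classicalNS_continuation_of_middleEigenvalue_integral_le hd hν hT h hmean hΛc hΛ0
    (fun t ht x hx => (NeustupaPenel2003.middleEigenvalue_le_top_and_le_neg_bot hd
      ((h.smooth_velocity.isSmooth_slice ht).isContDiff (by simp)) (h.divFree t ht) x hx).2.trans (hΛ t ht x hx)) hI

/-- **Neustupa–Penel, the `ζ₃` alternative, `3/2 < s < ∞`** (CRAS 336 (2003) Thm 2.1, scaling line
`2/r + 3/s = 2`, `r = 2s/(2s−3)`), continuation form on `T³`: a continuous nonnegative majorant FIELD
`Λ(t, ·) ≥ ζ₃(t, ·)` of the top eigenvalue of the strain matrix, a continuous `N(t) ≥ ‖Λ(t)‖_{L^q}`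
and `∫₀ᵗ N^{2q/(2q−3)} ≤ I` for all `t < T` yield continuation past `T` (since `(ζ₂)₊ ≤ ζ₃`, by
Miller's `Torus.classicalNS_continuation_of_middleEigenvalue_Lq_rpow_integral_le`).
[cite: NeustupaPenel2003, Thm 2.1 (case ζ₃, 3/2 < s < ∞); Miller2019, Thm 1.1] -/
theorem Torus.classicalNS_continuation_of_topEigenvalue_Lq_rpow_integral_le
    (hd : Fintype.card d = 3) {ν T q : ℝ} (hν : 0 < ν) (hT : 0 < T) (hq : 3 / 2 < q)
    {u : ℝ → UnitAddTorus d → EuclideanSpace ℝ d} {p : ℝ → UnitAddTorus d → ℝ}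
    (h : Torus.IsClassicalNSSolutionOn (Ico 0 T) ν 0 u p)
    (hmean : ∀ t ∈ Ico 0 T, Torus.HasZeroMean (u t)) {Λ : ℝ → UnitAddTorus d → ℝ}
    (hΛc : ∀ t ∈ Ico 0 T, Continuous (Λ t)) (hΛ0 : ∀ t ∈ Ico 0 T, ∀ x, 0 ≤ Λ t x)
    (hΛ : ∀ t ∈ Ico 0 T, ∀ x, ∀ hx : (Matrix.of fun i j =>
        (Torus.partialDeriv j (u t) x i + Torus.partialDeriv i (u t) x j) / 2).IsHermitian,
        hx.eigenvalues₀ (Fin.cast hd.symm 0) ≤ Λ t x)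
    {N : ℝ → ℝ} (hNc : ContinuousOn N (Ico 0 T)) (hN0 : ∀ t ∈ Ico 0 T, 0 ≤ N t)
    (hN : ∀ t ∈ Ico 0 T, (∫ x, Λ t x ^ q) ^ (1 / q) ≤ N t)
    {I : ℝ} (hI : ∀ t ∈ Ico 0 T, ∫ τ in (0 : ℝ)..t, N τ ^ (2 * q / (2 * q - 3)) ≤ I) :
    ∃ T' : ℝ, T < T' ∧ ∃ (u' : ℝ → UnitAddTorus d → EuclideanSpace ℝ d)
      (p' : ℝ → UnitAddTorus d → ℝ), Torus.IsClassicalNSSolutionOn (Icc 0 T') ν 0 u' p' ∧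
        (∀ t ∈ Icc 0 T', Torus.HasZeroMean (u' t)) ∧ ∀ t ∈ Ico 0 T, u' t = u t :=
  Torus.classicalNS_continuation_of_middleEigenvalue_Lq_rpow_integral_le hd hν hT hq h hmean hΛc hΛ0
    (fun t ht x hx => (NeustupaPenel2003.middleEigenvalue_le_top_and_le_neg_bot hd
      ((h.smooth_velocity.isSmooth_slice ht).isContDiff (by simp)) (h.divFree t ht) x hx).1.trans (hΛ t ht x hx)) hNc hN0 hN hI

/-- **Neustupa–Penel, the `ζ₁` alternative, `3/2 < s < ∞`** (CRAS 336 (2003) Thm 2.1, scaling line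
`2/r + 3/s = 2`), continuation form on `T³`: a continuous nonnegative majorant FIELD
`Λ(t, ·) ≥ −ζ₁(t, ·) = |ζ₁(t, ·)|` of the bottom eigenvalue of the strain matrix, a continuous
`N(t) ≥ ‖Λ(t)‖_{L^q}` and `∫₀ᵗ N^{2q/(2q−3)} ≤ I` for all `t < T` yield continuation past `T`
(since `(ζ₂)₊ ≤ −ζ₁`). [cite: NeustupaPenel2003, Thm 2.1 (case ζ₁, 3/2 < s < ∞); Miller2019, Thm 1.1] -/
theorem Torus.classicalNS_continuation_of_negBotEigenvalue_Lq_rpow_integral_le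
    (hd : Fintype.card d = 3) {ν T q : ℝ} (hν : 0 < ν) (hT : 0 < T) (hq : 3 / 2 < q)
    {u : ℝ → UnitAddTorus d → EuclideanSpace ℝ d} {p : ℝ → UnitAddTorus d → ℝ}
    (h : Torus.IsClassicalNSSolutionOn (Ico 0 T) ν 0 u p)
    (hmean : ∀ t ∈ Ico 0 T, Torus.HasZeroMean (u t)) {Λ : ℝ → UnitAddTorus d → ℝ}
    (hΛc : ∀ t ∈ Ico 0 T, Continuous (Λ t)) (hΛ0 : ∀ t ∈ Ico 0 T, ∀ x, 0 ≤ Λ t x)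
    (hΛ : ∀ t ∈ Ico 0 T, ∀ x, ∀ hx : (Matrix.of fun i j =>
        (Torus.partialDeriv j (u t) x i + Torus.partialDeriv i (u t) x j) / 2).IsHermitian,
        -hx.eigenvalues₀ (Fin.cast hd.symm 2) ≤ Λ t x)
    {N : ℝ → ℝ} (hNc : ContinuousOn N (Ico 0 T)) (hN0 : ∀ t ∈ Ico 0 T, 0 ≤ N t)
    (hN : ∀ t ∈ Ico 0 T, (∫ x, Λ t x ^ q) ^ (1 / q) ≤ N t)
    {I : ℝ} (hI : ∀ t ∈ Ico 0 T, ∫ τ in (0 : ℝ)..t, N τ ^ (2 * q / (2 * q - 3)) ≤ I) :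
    ∃ T' : ℝ, T < T' ∧ ∃ (u' : ℝ → UnitAddTorus d → EuclideanSpace ℝ d)
      (p' : ℝ → UnitAddTorus d → ℝ), Torus.IsClassicalNSSolutionOn (Icc 0 T') ν 0 u' p' ∧
        (∀ t ∈ Icc 0 T', Torus.HasZeroMean (u' t)) ∧ ∀ t ∈ Ico 0 T, u' t = u t :=
  Torus.classicalNS_continuation_of_middleEigenvalue_Lq_rpow_integral_le hd hν hT hq h hmean hΛc hΛ0
    (fun t ht x hx => (NeustupaPenel2003.middleEigenvalue_le_top_and_le_neg_bot hd
      ((h.smooth_velocity.isSmooth_slice ht).isContDiff (by simp)) (h.divFree t ht) x hx).2.trans (hΛ t ht x hx)) hNc hN0 hN hI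

end Literature.Analysis.FluidPDE
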